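import Literature.NumberTheory.LFunctions.KloostermanIncompleteSplit
import HarnessLib

/-!
# Bilinear forms with Kloosterman fractions: the complementary divisor (Bettin–Chandee §4.1.1)

Topic `NumberTheory/LFunctions`.  S. Bettin, V. Chandee, *Trilinear forms with Kloosterman
fractions*, Adv. Math. 328 (2018), §4.1.1 "Introducing the complementary divisor" (following
Duke–Friedlander–Iwaniec, Invent. Math. 128 (1997)): in the off-diagonal terms
`∑_{m ∼ M} ∑_{ℓ₁n₁ ≡ ℓ₂n₂ (mod m), ℓ₁n₁ ≠ ℓ₂n₂} … e(ϑ m̄/(bn₁) - ϑ m̄/(bn₂))` "we wish to switch to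
the complementary divisor of the congruence condition … so we write this as
`md₀ = ℓ₁𝔭₁𝔭₂n₁' - ℓ₂𝔮₁𝔮₂n₂'`, `d₀ ∈ ℤ_{≠0}` … Thus, to eliminate the variable `m`, it remains to
express the condition `(m, b𝔮₁𝔭₂) = 1` and the argument of the exponential in terms of the
remaining variables.  We do this by dividing the sum over `m` according to the residue classes
`m ≡ c (mod b𝔮₁𝔭₂)` for `c ∈ (ℤ/b𝔮₁𝔭₂ℤ)^*` … `m̄ ≡ -d (ℓ̃₂𝔮₂n₂')‾ (𝔭₁n₁')` … since for
`(β,γ) = (α,βγ) = 1` we have `ᾱ/(βγ) ≡ (αβ)‾/γ + (αγ)‾/β (mod 1)`."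

This file PROVES these devices as stand-alone lemmas (case `𝔭ᵢ = 𝔮ᵢ = 1`, `A = 1`):

* `kfs_msum_eq_dsum` — for `w ≠ 0`, `|w| ≤ D(M₁+1)`:
  `∑_{M₁<m≤M₂, (m,b)=1, m∣w} F(m) = ∑_{0<|d|≤D, d∣w, M₁<w/d≤M₂, (w/d,b)=1} F(w/d)`;
* `kfs_split_classes` — `[(x,b)=1] G(x mod b) = ∑_{c ∈ (ℤ/b)^*} [x ≡ c (mod b)] G(c)`;
* `kfs_phase_factor` — `e(k m̄^{(bn)}/(bn)) = e(k (mn)‾^{(b)}/b) e(k (mb)‾^{(n)}/n)` (`KI_e_inv_crt`),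
  `kfs_phase_mod_b` — the first factor only depends on `m (mod b)`,
  `kfs_phase_subst` — `md = w ≡ -R (mod n)` ⟹ `e(k (mb)‾/n) = e((-kd)(bR)‾/n)`;
* `KI_sum_interval_progression_le` — the Kloosterman-sum bound that will be applied to the resulting
  `n₂`-sums: `x` in an interval with `x ≡ V (mod q)`, `(x, s) = 1`, `(x, δ) = 1`, general `(q, s)`
  (a wrapper of `KI_sum_progression_split_le`),
and `kfs_e_congr_int` (`e(a y/q)` depends on `y mod q`).

## References

* S. Bettin, V. Chandee, Adv. Math. 328 (2018) 1234–1262 (arXiv:1502.00769), §4.1.1 and Appendix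
  Lemma 1. [BettinChandee2018]
* W. Duke, J. Friedlander, H. Iwaniec, Invent. Math. 128 (1997) 23–43. [DukeFriedlanderIwaniec1997]
-/

noncomputable section

open Finset

namespace Literature.NumberTheory.LFunctions

/-! ### Switching from `m` to the complementary divisor `d = (ℓ₁n₁ - ℓ₂n₂)/m` -/

/-- **The complementary divisor.**  For an integer `w ≠ 0`, `b ≥ 1`, `M₁ ≤ M₂` and `D` with
`|w| ≤ D (M₁ + 1)`, and any `F`,
`∑_{M₁ < m ≤ M₂, (m,b)=1, m ∣ w} F(m) = ∑_{0 < |d| ≤ D : d ∣ w, M₁ < w/d ≤ M₂, (w/d, b) = 1} F(w/d)`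
(the map `m ↦ d = w/m` is a bijection; Bettin–Chandee §4.1.1: "we switch to the complementary
divisor `d` of the congruence condition `ℓ₁n₁ ≡ ℓ₂n₂ (mod m)` … `md₀ = ℓ₁𝔭₁𝔭₂n₁' - ℓ₂𝔮₁𝔮₂n₂'`,
`d₀ ∈ ℤ_{≠0}` … `𝔮₁𝔭₂|d| ≤ D`"). [cite: BettinChandee2018, §4.1.1] -/
theorem kfs_msum_eq_dsum {w : ℤ} (hw : w ≠ 0) (b M₁ M₂ D : ℕ)
    (hD : w.natAbs ≤ D * (M₁ + 1)) (F : ℕ → ℂ) :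
    ∑ m ∈ (Ioc M₁ M₂).filter (fun m => m.Coprime b), (if (m : ℤ) ∣ w then F m else 0) =
      ∑ d ∈ (Icc (-(D : ℤ)) D).erase 0,
        (if d ∣ w ∧ (M₁ : ℤ) < w / d ∧ w / d ≤ M₂ ∧ Int.gcd (w / d) b = 1 then
          F (w / d).toNat else 0) := by
  rw [← Finset.sum_filter, ← Finset.sum_filter]
  refine Finset.sum_nbij' (fun m : ℕ => w / (m : ℤ)) (fun d : ℤ => (w / d).toNat) ?_ ?_ ?_ ?_ ?_
  · -- `m ↦ w/m` lands in the `d`-set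
    intro m hm
    simp only [Finset.mem_filter, Finset.mem_Ioc] at hm
    obtain ⟨⟨⟨hm1, hm2⟩, hmb⟩, hmw⟩ := hm
    obtain ⟨t, ht⟩ := hmw
    have hm0 : (m : ℤ) ≠ 0 := by exact_mod_cast (show m ≠ 0 by omega)
    have htdef : w / (m : ℤ) = t := by rw [ht, Int.mul_ediv_cancel_left _ hm0]
    have ht0 : t ≠ 0 := by rintro rfl; rw [mul_zero] at ht; exact hw ht
    simp only [Finset.mem_filter, Finset.mem_erase, Finset.mem_Icc]
    rw [htdef]
    refine ⟨⟨ht0, ?_⟩, ⟨⟨(m : ℤ), by rw [ht, mul_comm]⟩, ?_, ?_, ?_⟩⟩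
    · -- `|t| ≤ D` from `|w| = m |t| ≤ D (M₁+1) ≤ D m`
      have h1 : w.natAbs = m * t.natAbs := by rw [ht, Int.natAbs_mul, Int.natAbs_natCast]
      have h2 : m * t.natAbs ≤ D * m := by
        calc m * t.natAbs = w.natAbs := h1.symm
          _ ≤ D * (M₁ + 1) := hD
          _ ≤ D * m := Nat.mul_le_mul_left D hm1
      have h3 : t.natAbs ≤ D := by
        have hm' : 0 < m := by omega
        rw [mul_comm] at h2
        exact Nat.le_of_mul_le_mul_right h2 hm'
      constructor <;> omega
    · rw [ht, Int.mul_ediv_cancel _ ht0]; exact_mod_cast hm1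
    · rw [ht, Int.mul_ediv_cancel _ ht0]; exact_mod_cast hm2
    · rw [ht, Int.mul_ediv_cancel _ ht0, Int.gcd_natCast_natCast]; exact hmb
  · -- `d ↦ w/d` lands in the `m`-set
    intro d hd
    simp only [Finset.mem_filter, Finset.mem_erase, Finset.mem_Icc] at hd
    obtain ⟨⟨hd0, _⟩, ⟨hdw, h1, h2, h3⟩⟩ := hd
    have hq0 : 0 ≤ w / d := by
      have : (0 : ℤ) ≤ M₁ := by positivity
      linarith
    have hcast : (((w / d).toNat : ℕ) : ℤ) = w / d := Int.toNat_of_nonneg hq0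
    simp only [Finset.mem_filter, Finset.mem_Ioc]
    refine ⟨⟨⟨?_, ?_⟩, ?_⟩, ?_⟩
    · have : (M₁ : ℤ) < ((w / d).toNat : ℕ) := by rw [hcast]; exact h1
      exact_mod_cast this
    · have : (((w / d).toNat : ℕ) : ℤ) ≤ M₂ := by rw [hcast]; exact h2
      exact_mod_cast this
    · show Nat.gcd (w / d).toNat b = 1
      rw [← Int.gcd_natCast_natCast, hcast]; exact h3
    · rw [hcast]; exact ⟨d, (Int.ediv_mul_cancel hdw).symm⟩
  · -- left inverse
    intro m hm
    simp only [Finset.mem_filter, Finset.mem_Ioc] at hm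
    obtain ⟨⟨⟨hm1, _⟩, _⟩, hmw⟩ := hm
    obtain ⟨t, ht⟩ := hmw
    have hm0 : (m : ℤ) ≠ 0 := by exact_mod_cast (show m ≠ 0 by omega)
    have ht0 : t ≠ 0 := by rintro rfl; rw [mul_zero] at ht; exact hw ht
    show (w / (w / (m : ℤ))).toNat = m
    rw [ht, Int.mul_ediv_cancel_left _ hm0, Int.mul_ediv_cancel _ ht0, Int.toNat_natCast]
  · -- right inverse
    intro d hd
    simp only [Finset.mem_filter, Finset.mem_erase, Finset.mem_Icc] at hd
    obtain ⟨⟨hd0, _⟩, ⟨hdw, h1, _, _⟩⟩ := hd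
    have hq0 : 0 ≤ w / d := by
      have : (0 : ℤ) ≤ M₁ := by positivity
      linarith
    show w / (((w / d).toNat : ℕ) : ℤ) = d
    rw [Int.toNat_of_nonneg hq0]
    obtain ⟨t, ht⟩ := hdw
    rw [ht, Int.mul_ediv_cancel_left _ hd0]
    have ht0 : t ≠ 0 := by rintro rfl; rw [mul_zero] at ht; exact hw ht
    rw [Int.mul_ediv_cancel _ ht0]
  · -- summands agree
    intro m hm
    simp only [Finset.mem_filter, Finset.mem_Ioc] at hm
    obtain ⟨⟨⟨hm1, _⟩, _⟩, hmw⟩ := hm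
    obtain ⟨t, ht⟩ := hmw
    have hm0 : (m : ℤ) ≠ 0 := by exact_mod_cast (show m ≠ 0 by omega)
    have ht0 : t ≠ 0 := by rintro rfl; rw [mul_zero] at ht; exact hw ht
    show F m = F (w / (w / (m : ℤ))).toNat
    rw [ht, Int.mul_ediv_cancel_left _ hm0, Int.mul_ediv_cancel _ ht0, Int.toNat_natCast]

/-- **Splitting into classes modulo `b`**: for `b ≥ 1`, an integer `x` and `G`,
`[(x, b) = 1] G(x mod b) = ∑_{0 ≤ c < b, (c,b)=1} [x ≡ c (mod b)] G(c)`.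
(Bettin–Chandee §4.1.1: "dividing the sum over `m` according to the residue classes
`m ≡ c (mod b𝔮₁𝔭₂)` for `c ∈ (ℤ/b𝔮₁𝔭₂ℤ)^*`".) [cite: BettinChandee2018, §4.1.1] -/
theorem kfs_split_classes {b : ℕ} (hb : 0 < b) (x : ℤ) (G : ℕ → ℂ) :
    (if Int.gcd x b = 1 then G (x % b).toNat else 0) =
      ∑ c ∈ (Finset.range b).filter (fun c => c.Coprime b),
        (if x ≡ (c : ℤ) [ZMOD b] then G c else 0) := by
  have hb' : (0 : ℤ) < b := by exact_mod_cast hb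
  have hx0 : 0 ≤ x % b := Int.emod_nonneg _ hb'.ne'
  have hx1 : x % b < b := Int.emod_lt_of_pos _ hb'
  set c₀ : ℕ := (x % b).toNat with hc₀
  have hc₀' : (c₀ : ℤ) = x % b := Int.toNat_of_nonneg hx0
  have hc₀b : c₀ < b := by omega
  -- the class of `x` is `c₀`, and only `c = c₀` can contribute
  have hiff : ∀ c : ℕ, c < b → (x ≡ (c : ℤ) [ZMOD b] ↔ c = c₀) := by
    intro c hc
    rw [Int.ModEq, Int.emod_eq_of_lt (by positivity : (0 : ℤ) ≤ c) (by exact_mod_cast hc)]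
    constructor
    · intro h; apply Nat.cast_injective (R := ℤ); rw [hc₀', h]
    · intro h; rw [h, hc₀']
  haveI : NeZero b := ⟨hb.ne'⟩
  have hcast : (x : ZMod b) = ((c₀ : ℕ) : ZMod b) := by
    rw [← ZMod.intCast_mod x b, ← hc₀', Int.cast_natCast]
  have hunit : Int.gcd x b = 1 ↔ c₀.Coprime b := by
    rw [Literature.NumberTheory.Sieve.Iwaniec1978.hooley_gcd_eq_one_iff_isUnit, hcast,
      ZMod.isUnit_iff_coprime]
  rw [Finset.sum_filter,
    Finset.sum_eq_single_of_mem c₀ (Finset.mem_range.mpr hc₀b) (fun c hc hne => ?_)]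
  · by_cases hcop : c₀.Coprime b
    · rw [if_pos hcop, if_pos ((hiff c₀ hc₀b).mpr rfl), if_pos (hunit.mpr hcop)]
    · rw [if_neg hcop, if_neg (fun h => hcop (hunit.mp h))]
  · rw [Finset.mem_range] at hc
    by_cases h1 : c.Coprime b
    · rw [if_pos h1, if_neg (fun h2 => hne ((hiff c hc).mp h2))]
    · rw [if_neg h1]

/-! ### The phases in terms of `d` and of `m mod b` -/

/-- `e(a y/q) = e(a y'/q)` for integers `y ≡ y' (mod q)`. [folklore] -/
theorem kfs_e_congr_int (a : ℤ) {q : ℕ} (hq : 0 < q) {y y' : ℤ} (h : y ≡ y' [ZMOD q]) :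
    Complex.exp (2 * Real.pi * Complex.I * ((a : ℂ) * (y : ℂ) / (q : ℂ))) =
      Complex.exp (2 * Real.pi * Complex.I * ((a : ℂ) * (y' : ℂ) / (q : ℂ))) := by
  obtain ⟨t, ht⟩ : ∃ t : ℤ, y = y' + q * t := by
    have := (Int.modEq_iff_dvd.mp h.symm)
    obtain ⟨t, ht⟩ := this
    exact ⟨t, by linarith⟩
  have hq0 : (q : ℂ) ≠ 0 := by exact_mod_cast hq.ne'
  have key : 2 * (Real.pi : ℂ) * Complex.I * ((a : ℂ) * (y : ℂ) / (q : ℂ)) =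
      2 * Real.pi * Complex.I * ((a : ℂ) * (y' : ℂ) / (q : ℂ)) +
        ((a * t : ℤ) : ℂ) * (2 * Real.pi * Complex.I) := by
    rw [ht]; push_cast; field_simp
  rw [key, Complex.exp_add, Complex.exp_int_mul_two_pi_mul_I, mul_one]

/-- **Factorisation of the phase** `e(k m̄^{(bn)}/(bn)) = e(k (mn)‾^{(b)}/b) · e(k (mb)‾^{(n)}/n)`
for `(b, n) = 1` and `(m, bn) = 1`: the first factor only depends on `m (mod b)` (and `n`), the
second carries the Kloosterman fraction modulo `n` (Bettin–Chandee §4.1.1 (vae):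
"`ᾱ/(βγ) ≡ (αβ)‾/γ + (αγ)‾/β (mod 1)`"). [cite: BettinChandee2018, §4.1.1] -/
theorem kfs_phase_factor (k : ℤ) {b n m : ℕ} (hb : 0 < b) (hn : 0 < n) (hbn : b.Coprime n)
    (hm : m.Coprime (b * n)) :
    Complex.exp (2 * Real.pi * Complex.I *
        ((k : ℂ) * ((((m : ZMod (b * n))⁻¹).val : ℕ) : ℂ) / ((b * n : ℕ) : ℂ))) =
      Complex.exp (2 * Real.pi * Complex.I *
          ((k : ℂ) * ((((((m : ℤ) * n : ℤ) : ZMod b)⁻¹).val : ℕ) : ℂ) / (b : ℂ))) *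
        Complex.exp (2 * Real.pi * Complex.I *
          ((k : ℂ) * ((((((m : ℤ) * b : ℤ) : ZMod n)⁻¹).val : ℕ) : ℂ) / (n : ℂ))) := by
  have hx : IsUnit (((m : ℤ) : ZMod (b * n))) := by
    rw [Int.cast_natCast]; exact (ZMod.isUnit_iff_coprime m (b * n)).mpr hm
  have h := KI_e_inv_crt hb hn hbn k hx
  rw [Int.cast_natCast] at h
  exact h

/-- **The inverse in terms of the complementary divisor**: if `m d = w` with `w ≡ -R (mod n)`
and `bR` invertible modulo `n`, then `(mb)‾ ≡ -d (bR)‾ (mod n)`, so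
`e(k (mb)‾^{(n)}/n) = e((-kd) (bR)‾^{(n)}/n)` (Bettin–Chandee §4.1.1: "`m ≡ -d (ℓ̃₂𝔮₂n₂')‾ 𝔭₁n₁'`
…"; here `R = ℓ₂n₂`, modulus `n = n₁`). [cite: BettinChandee2018, §4.1.1] -/
theorem kfs_phase_subst (k : ℤ) {n : ℕ} (hn : 0 < n) {b : ℕ} {m d w R : ℤ} (hmd : m * d = w)
    (hw : (n : ℤ) ∣ w + R) (hu : IsUnit ((b * R : ℤ) : ZMod n)) :
    Complex.exp (2 * Real.pi * Complex.I *
        ((k : ℂ) * ((((( m * b : ℤ) : ZMod n)⁻¹).val : ℕ) : ℂ) / (n : ℂ))) =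
      Complex.exp (2 * Real.pi * Complex.I *
        (((-(k * d) : ℤ) : ℂ) * (((((b * R : ℤ) : ZMod n)⁻¹).val : ℕ) : ℂ) / (n : ℂ))) := by
  haveI : NeZero n := ⟨hn.ne'⟩
  -- `w ≡ -R (mod n)`
  have hwR : ((w : ℤ) : ZMod n) = -(R : ZMod n) := by
    have : ((w + R : ℤ) : ZMod n) = 0 := (ZMod.intCast_zmod_eq_zero_iff_dvd _ n).mpr hw
    push_cast at this
    linear_combination this
  -- the inverse of `m b`
  have hinv : ((m * b : ℤ) : ZMod n)⁻¹ = (-(d : ZMod n)) * ((b * R : ℤ) : ZMod n)⁻¹ := by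
    apply ZMod.inv_eq_of_mul_eq_one
    have hmd' : (m : ZMod n) * (d : ZMod n) = (w : ZMod n) := by exact_mod_cast congrArg (fun z : ℤ => (z : ZMod n)) hmd
    push_cast
    calc (m : ZMod n) * (b : ZMod n) * (-(d : ZMod n) * ((b : ZMod n) * (R : ZMod n))⁻¹)
        = -((m : ZMod n) * (d : ZMod n)) * (b : ZMod n) * ((b : ZMod n) * (R : ZMod n))⁻¹ := by
          ring
      _ = ((b : ZMod n) * (R : ZMod n)) * ((b : ZMod n) * (R : ZMod n))⁻¹ := by
          rw [hmd', hwR]; ring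
      _ = 1 := by
          have := ZMod.mul_inv_of_unit _ hu
          push_cast at this
          exact this
  -- compare the two `val`s modulo `n`
  have hmod : (((((m * b : ℤ) : ZMod n)⁻¹).val : ℕ) : ℤ) ≡
      (-d) * (((((b * R : ℤ) : ZMod n)⁻¹).val : ℕ) : ℤ) [ZMOD n] := by
    rw [← ZMod.intCast_eq_intCast_iff]
    have hl : (((((( m * b : ℤ) : ZMod n)⁻¹).val : ℕ) : ℤ) : ZMod n) =
        ((m * b : ℤ) : ZMod n)⁻¹ := by
      rw [Int.cast_natCast, ZMod.natCast_zmod_val]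
    have hr : (((-d) * (((((b * R : ℤ) : ZMod n)⁻¹).val : ℕ) : ℤ) : ℤ) : ZMod n) =
        (-(d : ZMod n)) * ((b * R : ℤ) : ZMod n)⁻¹ := by
      rw [Int.cast_mul, Int.cast_neg, Int.cast_natCast, ZMod.natCast_zmod_val]
    rw [hl, hr, hinv]
  have h := kfs_e_congr_int k hn hmod
  have e1 : (k : ℂ) * ((((((m * b : ℤ) : ZMod n)⁻¹).val : ℕ) : ℤ) : ℂ) =
      (k : ℂ) * (((((m * b : ℤ) : ZMod n)⁻¹).val : ℕ) : ℂ) := by push_cast; ring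
  have e2 : (k : ℂ) * (((-d) * (((((b * R : ℤ) : ZMod n)⁻¹).val : ℕ) : ℤ) : ℤ) : ℂ) =
      ((-(k * d) : ℤ) : ℂ) * (((((b * R : ℤ) : ZMod n)⁻¹).val : ℕ) : ℂ) := by push_cast; ring
  rw [e1, e2] at h
  exact h

/-- The factor modulo `b` only depends on `m (mod b)`: if `m ≡ c (mod b)` then
`e(k (mn)‾^{(b)}/b) = e(k (cn)‾^{(b)}/b)`. [folklore] -/
theorem kfs_phase_mod_b (k : ℤ) (b n : ℕ) {m c : ℤ} (h : m ≡ c [ZMOD b]) :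
    Complex.exp (2 * Real.pi * Complex.I *
        ((k : ℂ) * (((((m * n : ℤ) : ZMod b)⁻¹).val : ℕ) : ℂ) / (b : ℂ))) =
      Complex.exp (2 * Real.pi * Complex.I *
        ((k : ℂ) * (((((c * n : ℤ) : ZMod b)⁻¹).val : ℕ) : ℂ) / (b : ℂ))) := by
  have : ((m * n : ℤ) : ZMod b) = ((c * n : ℤ) : ZMod b) := by
    push_cast
    rw [(ZMod.intCast_eq_intCast_iff _ _ _).mpr h]
  rw [this]

/-! ### The `n₂`-sum: an interval with a congruence condition (wrapper of `KI_sum_progression_split_le`) -/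

/-- **Incomplete Kloosterman sum over `{x₁ < x ≤ x₂ : x ≡ V (mod q), (x, s) = 1, (x, δ) = 1}`**,
general `(q, s)`: with `s = s₁ s₂`, `(s₁, s₂) = 1`, `m₀ ≥ 1`, `s₁ ∣ q m₀`, `(q m₀, s₂) = 1`,
`(δ, q m₀) = 1` and `q ≥ 1`,
`‖∑ e(a x̄/s)‖ ≤ m₀ τ(δ) ( (((x₂-x₁)/q + 1)/m₀ + 2)/s₂ (a,s₂) + τ(s₂) √s₂ √(a,s₂) (1 + log s₂) )`
(write `x = V + q y`). [cite: BettinChandee2018, Appendix Lemma 1] -/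
theorem KI_sum_interval_progression_le {s s₁ s₂ : ℕ} (hs : s = s₁ * s₂) (hs₁ : 0 < s₁)
    (hs₂ : 0 < s₂) (hcop : s₁.Coprime s₂) {q m₀ : ℕ} (hq : 0 < q) (hm₀ : 0 < m₀)
    (hqm : (q * m₀).Coprime s₂) (hdiv : s₁ ∣ q * m₀) {δ : ℕ} (hδ : 0 < δ)
    (hδq : δ.Coprime (q * m₀)) (a V x₁ x₂ : ℤ) (hx : x₁ ≤ x₂) :
    ‖∑ x ∈ (Finset.Ioc x₁ x₂).filter (fun x : ℤ =>
        x ≡ V [ZMOD q] ∧ (Int.gcd x s = 1 ∧ Int.gcd x δ = 1)),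
        Complex.exp (2 * Real.pi * Complex.I *
          ((a : ℂ) * ((((x : ZMod s)⁻¹).val : ℕ) : ℂ) / (s : ℂ)))‖ ≤
      m₀ * ((Nat.divisors δ).card *
        ((((((x₂ - x₁ : ℤ) : ℝ)) / q + 1) / m₀ + 2) / s₂ * Int.gcd a s₂ +
          (Nat.divisors s₂).card * Real.sqrt s₂ * Real.sqrt (Int.gcd a s₂) *
            (1 + Real.log s₂))) := by
  classical
  have hq' : (0 : ℤ) < q := by exact_mod_cast hq
  -- reparametrise `x = z q + V`
  have hset : (Finset.Ioc x₁ x₂).filter (fun x : ℤ =>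
        x ≡ V [ZMOD q] ∧ (Int.gcd x s = 1 ∧ Int.gcd x δ = 1)) =
      ((((Finset.Ioc (x₁ - V) (x₂ - V)).filter (fun x : ℤ => (q : ℤ) ∣ x)).map
          ⟨(· + V), add_left_injective V⟩).filter
        (fun x : ℤ => Int.gcd x s = 1 ∧ Int.gcd x δ = 1)) := by
    rw [← Int.Ioc_filter_modEq_eq, Finset.filter_filter]
  rw [hset, Int.Ioc_filter_dvd_eq _ _ hq', Finset.map_map, Finset.sum_filter, Finset.sum_map]
  simp only [Function.Embedding.trans_apply, Function.Embedding.coeFn_mk]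
  rw [← Finset.sum_filter]
  set z₁ : ℤ := ⌊((x₁ - V : ℤ) : ℚ) / (q : ℤ)⌋ with hz₁
  set z₂ : ℤ := ⌊((x₂ - V : ℤ) : ℚ) / (q : ℤ)⌋ with hz₂
  have hz : z₁ ≤ z₂ := by
    rw [hz₁, hz₂]
    refine Int.floor_le_floor (div_le_div_of_nonneg_right ?_ (by exact_mod_cast hq.le))
    exact_mod_cast (show x₁ - V ≤ x₂ - V by linarith)
  have hz' : ((z₂ - z₁ : ℤ) : ℝ) ≤ ((x₂ - x₁ : ℤ) : ℝ) / q + 1 := by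
    have h1 : ((z₂ : ℤ) : ℚ) ≤ ((x₂ - V : ℤ) : ℚ) / (q : ℤ) := by rw [hz₂]; exact Int.floor_le _
    have h2 : ((x₁ - V : ℤ) : ℚ) / (q : ℤ) < ((z₁ : ℤ) : ℚ) + 1 := by
      rw [hz₁]; exact Int.lt_floor_add_one _
    have h3 : ((z₂ - z₁ : ℤ) : ℚ) ≤ ((x₂ - x₁ : ℤ) : ℚ) / (q : ℤ) + 1 := by
      have h4 : ((x₂ - V : ℤ) : ℚ) / (q : ℤ) - ((x₁ - V : ℤ) : ℚ) / (q : ℤ) =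
          ((x₂ - x₁ : ℤ) : ℚ) / (q : ℤ) := by push_cast; ring
      push_cast at h1 h2 h4 ⊢
      linarith
    have h6 : (((z₂ - z₁ : ℤ) : ℚ) : ℝ) ≤ ((((x₂ - x₁ : ℤ) : ℚ) / (q : ℤ) + 1 : ℚ) : ℝ) := by
      exact_mod_cast h3
    push_cast at h6 ⊢
    exact h6
  -- the summand in the form `v + q y`
  have hlin : ∀ z : ℤ, z * q + V = V + (q : ℤ) * z := fun z => by ring
  have hsum : ∑ z ∈ (Finset.Ioc z₁ z₂).filter (fun z : ℤ =>
        Int.gcd (z * q + V) s = 1 ∧ Int.gcd (z * q + V) δ = 1),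
        Complex.exp (2 * Real.pi * Complex.I *
          ((a : ℂ) * (((((z * q + V : ℤ) : ZMod s)⁻¹).val : ℕ) : ℂ) / (s : ℂ))) =
      ∑ z ∈ (Finset.Ioc z₁ z₂).filter (fun z : ℤ =>
        Int.gcd (V + q * z) s = 1 ∧ Int.gcd (V + q * z) δ = 1),
        Complex.exp (2 * Real.pi * Complex.I *
          ((a : ℂ) * (((((V + q * z : ℤ) : ZMod s)⁻¹).val : ℕ) : ℂ) / (s : ℂ))) := by
    rw [Finset.filter_congr (fun z _ => by rw [hlin z])]
    exact Finset.sum_congr rfl fun z _ => by rw [hlin z]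
  rw [hsum]
  refine (KI_sum_progression_split_le hs hs₁ hs₂ hcop hm₀ hqm hdiv hδ hδq a V z₁ z₂ hz).trans ?_
  have hm₀r : (0 : ℝ) < m₀ := by exact_mod_cast hm₀
  have hs₂r : (0 : ℝ) < s₂ := by exact_mod_cast hs₂
  have hτ : (0 : ℝ) ≤ (Nat.divisors δ).card := Nat.cast_nonneg _
  have hg : (0 : ℝ) ≤ Int.gcd a s₂ := Nat.cast_nonneg _
  have hmain : (((z₂ - z₁ : ℤ) : ℝ) / m₀ + 2) / s₂ * Int.gcd a s₂ ≤
      ((((x₂ - x₁ : ℤ) : ℝ) / q + 1) / m₀ + 2) / s₂ * Int.gcd a s₂ := by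
    gcongr
  refine mul_le_mul_of_nonneg_left (mul_le_mul_of_nonneg_left ?_ hτ) hm₀r.le
  linarith

end Literature.NumberTheory.LFunctions

end
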